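import Summits.ValiantsHypothesis.ValiantsHypothesis.Theses.SymmetroidDescartes
import Summits.ValiantsHypothesis.ValiantsHypothesis.Theorems.SymmetroidDescartesRolleToDescartes
import Summits.ValiantsHypothesis.ValiantsHypothesis.Theorems.SymmetroidDescartesThetaPencilWitnessPencil

/-!
# Skeleton — refutation of `DerivedPencilRolle` (stmt-ValiantsHypothesis-18500), line `staircase-refutation`

Composition `not_DerivedPencilRolle : ¬ DerivedPencilRolle` modulo the stubs
`stub_walkSign`, `stub_walkDet`, `stub_arith`, `stub_stair` (see BLUEPRINT.md / Lines/staircase-refutation.md).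
The shared definitions (layered weighted walks) are inlined here until
`Theorems/SymmetroidDescartesDerivedPencilRolleWalkDefs.lean` lands; then this block is replaced by the import.
-/

set_option linter.dupNamespace false

-- ===== BEGIN inline copy of SymmetroidDescartesDerivedPencilRolleWalkDefs.lean =====
namespace Summit.ValiantsHypothesis.ValiantsHypothesis.Theorems.SymmetroidDescartes.DPR

/-- An edge label of a layered weighted digraph: weight `a : ℤ` (exponent of the small base `η`),
exponent class `cls : Fin K` (the `t`-exponent is read off an exponent table `d : Fin K → ℕ`), and a
sign bit `neg` (the real entry carries the sign `(-1)^neg`). [folklore] -/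
structure WEdge (K : ℕ) where
  /-- weight: the exponent of the small real base `η` -/
  a : ℤ
  /-- exponent class: index into the exponent table `d : Fin K → ℕ` -/
  cls : Fin K
  /-- sign bit: the real entry is multiplied by `-1` iff `neg` -/
  neg : Bool
deriving DecidableEq

/-- One layer of a layered weighted digraph on the vertex set `V`: `l v v' = some e` iff there is an
edge `v → v'` with label `e` between this column and the next. [folklore] -/
abbrev WLayer (V : Type*) (K : ℕ) := V → V → Option (WEdge K)

/-- The sign `(-1)^neg ∈ {1, -1} ⊂ ℤ` of an edge label. [folklore] -/
def WEdge.sgn {K : ℕ} (e : WEdge K) : ℤ := if e.neg then -1 else 1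

/-- Tropical cost of one step at the integer parameter `lam` for the exponent table `d`:
`a − lam · d cls`, and `⊤` for a missing edge. [folklore] -/
def stepCost {K : ℕ} (d : Fin K → ℕ) (lam : ℤ) : Option (WEdge K) → WithTop ℤ
  | none => ⊤
  | some e => ((e.a - lam * (d e.cls : ℤ) : ℤ) : WithTop ℤ)

/-- Tropical cost of a walk.  The walk through the layered graph `g` starts at `v` and `w` lists the
vertices visited after `v`, one per layer; the cost is the sum of the step costs, and `⊤` if some edge
is missing or `w.length ≠ g.length`. [folklore] -/
def walkCost {V : Type*} {K : ℕ} (d : Fin K → ℕ) (lam : ℤ) :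
    List (WLayer V K) → V → List V → WithTop ℤ
  | [], _, [] => 0
  | l :: g, v, v' :: w => stepCost d lam (l v v') + walkCost d lam g v' w
  | [], _, _ :: _ => ⊤
  | _ :: _, _, [] => ⊤

/-- Sign of a walk: the product of the edge signs `(-1)^neg` along it (a missing edge or a length
mismatch contributes the junk factor `1`; only walks of finite cost matter). [folklore] -/
def walkSign {V : Type*} {K : ℕ} : List (WLayer V K) → V → List V → ℤ
  | [], _, _ => 1
  | _ :: _, _, [] => 1
  | l :: g, v, v' :: w => (match l v v' with | none => 1 | some e => e.sgn) * walkSign g v' w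

/-- Real value of one step at base `η` and point `t`: `(-1)^neg · η^a · t^(d cls)` (`η^a` an integer
power), and `0` for a missing edge. [folklore] -/
noncomputable def stepVal {K : ℕ} (d : Fin K → ℕ) (η t : ℝ) : Option (WEdge K) → ℝ
  | none => 0
  | some e => (e.sgn : ℝ) * η ^ e.a * t ^ (d e.cls)

/-- Real value of a walk: the product of its step values (`0` if an edge is missing or the lengths do
not match, `1` for the empty walk through the empty graph). [folklore] -/
noncomputable def walkVal {V : Type*} {K : ℕ} (d : Fin K → ℕ) (η t : ℝ) :
    List (WLayer V K) → V → List V → ℝ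
  | [], _, [] => 1
  | l :: g, v, v' :: w => stepVal d η t (l v v') * walkVal d η t g v' w
  | [], _, _ :: _ => 0
  | _ :: _, _, [] => 0

/-- The real matrix of a layer at base `η` and point `t`: entry `(v, v')` is the step value of the edge
`v → v'`. [folklore] -/
noncomputable def layerMat {V : Type*} {K : ℕ} (d : Fin K → ℕ) (η t : ℝ) (l : WLayer V K) :
    Matrix V V ℝ :=
  Matrix.of fun v v' => stepVal d η t (l v v')

/-- The path sum of a layered graph from `v₀`: the sum over all end vertices `x` of the `(v₀, x)` entry
of the product of the layer matrices, i.e. the sum of the values of all walks from `v₀`. [folklore] -/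
noncomputable def pathSum {V : Type*} [Fintype V] [DecidableEq V] {K : ℕ} (d : Fin K → ℕ) (η t : ℝ)
    (g : List (WLayer V K)) (v₀ : V) : ℝ :=
  ∑ x, (g.map (layerMat d η t)).prod v₀ x

section unfolding

variable {V : Type*} {K : ℕ} (d : Fin K → ℕ)

/-- `walkCost` of the empty walk through the empty graph is `0`. [folklore] -/
@[simp] theorem walkCost_nil_nil (lam : ℤ) (v : V) :
    walkCost d lam ([] : List (WLayer V K)) v [] = 0 := rfl

/-- `walkCost` unfolds one layer. [folklore] -/
@[simp] theorem walkCost_cons_cons (lam : ℤ) (l : WLayer V K) (g : List (WLayer V K)) (v v' : V)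
    (w : List V) :
    walkCost d lam (l :: g) v (v' :: w) = stepCost d lam (l v v') + walkCost d lam g v' w := rfl

/-- A walk that is too long for the empty graph has cost `⊤`. [folklore] -/
@[simp] theorem walkCost_nil_cons (lam : ℤ) (v v' : V) (w : List V) :
    walkCost d lam ([] : List (WLayer V K)) v (v' :: w) = ⊤ := rfl

/-- A walk that is too short has cost `⊤`. [folklore] -/
@[simp] theorem walkCost_cons_nil (lam : ℤ) (l : WLayer V K) (g : List (WLayer V K)) (v : V) :
    walkCost d lam (l :: g) v [] = ⊤ := rfl

/-- `walkVal` of the empty walk through the empty graph is `1`. [folklore] -/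
@[simp] theorem walkVal_nil_nil (η t : ℝ) (v : V) :
    walkVal d η t ([] : List (WLayer V K)) v [] = 1 := rfl

/-- `walkVal` unfolds one layer. [folklore] -/
@[simp] theorem walkVal_cons_cons (η t : ℝ) (l : WLayer V K) (g : List (WLayer V K)) (v v' : V)
    (w : List V) :
    walkVal d η t (l :: g) v (v' :: w) = stepVal d η t (l v v') * walkVal d η t g v' w := rfl

/-- A walk that is too long for the empty graph has value `0`. [folklore] -/
@[simp] theorem walkVal_nil_cons (η t : ℝ) (v v' : V) (w : List V) :
    walkVal d η t ([] : List (WLayer V K)) v (v' :: w) = 0 := rfl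

/-- A walk that is too short has value `0`. [folklore] -/
@[simp] theorem walkVal_cons_nil (η t : ℝ) (l : WLayer V K) (g : List (WLayer V K)) (v : V) :
    walkVal d η t (l :: g) v [] = 0 := rfl

/-- `walkSign` unfolds one layer. [folklore] -/
@[simp] theorem walkSign_cons_cons (l : WLayer V K) (g : List (WLayer V K)) (v v' : V) (w : List V) :
    walkSign (l :: g) v (v' :: w)
      = (match l v v' with | none => 1 | some e => e.sgn) * walkSign g v' w := rfl

/-- `walkSign` through the empty graph is `1`. [folklore] -/
@[simp] theorem walkSign_nil (v : V) (w : List V) : walkSign ([] : List (WLayer V K)) v w = 1 := by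
  cases w <;> rfl

/-- `layerMat` entries are step values. [folklore] -/
@[simp] theorem layerMat_apply (η t : ℝ) (l : WLayer V K) (v v' : V) :
    layerMat d η t l v v' = stepVal d η t (l v v') := rfl

end unfolding

section append

variable {V : Type*} {K : ℕ} (d : Fin K → ℕ)

/-- The last vertex of a walk starting at `v` (the start itself for the empty walk). [folklore] -/
def walkLast (v : V) (w : List V) : V := w.getLastD v

/-- `walkLast` of a nonempty walk ignores the start. [folklore] -/
@[simp] theorem walkLast_cons (v v' : V) (w : List V) : walkLast v (v' :: w) = walkLast v' w := by
  cases w <;> rfl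

/-- `walkLast` of the empty walk is the start. [folklore] -/
@[simp] theorem walkLast_nil (v : V) : walkLast v ([] : List V) = v := rfl

/-- A walk of finite cost has the length of the graph. [folklore] -/
theorem length_eq_of_walkCost_ne_top (lam : ℤ) :
    ∀ (g : List (WLayer V K)) (v : V) (w : List V), walkCost d lam g v w ≠ ⊤ → w.length = g.length
  | [], _, [], _ => rfl
  | [], _, _ :: _, h => (h rfl).elim
  | _ :: _, _, [], h => (h rfl).elim
  | l :: g, v, v' :: w, h => by
      rw [walkCost_cons_cons, WithTop.add_ne_top] at h
      simp [length_eq_of_walkCost_ne_top lam g v' w h.2]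

/-- Cost of a walk through a concatenated graph: when the first part of the walk has the length of the
first graph, the cost is the sum of the two costs (the second walk starts where the first ends).
[folklore] -/
theorem walkCost_append (lam : ℤ) :
    ∀ (g₁ g₂ : List (WLayer V K)) (v : V) (w₁ w₂ : List V), w₁.length = g₁.length →
      walkCost d lam (g₁ ++ g₂) v (w₁ ++ w₂)
        = walkCost d lam g₁ v w₁ + walkCost d lam g₂ (walkLast v w₁) w₂
  | [], g₂, v, [], w₂, _ => by simp
  | [], _, _, _ :: _, _, h => by simp at h
  | _ :: _, _, _, [], _, h => by simp at h
  | l :: g₁, g₂, v, v' :: w₁, w₂, h => by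
      simp only [List.cons_append, walkCost_cons_cons, walkLast_cons]
      rw [walkCost_append lam g₁ g₂ v' w₁ w₂ (by simpa using h), add_assoc]

/-- Sign of a walk through a concatenated graph (first part of matching length). [folklore] -/
theorem walkSign_append :
    ∀ (g₁ g₂ : List (WLayer V K)) (v : V) (w₁ w₂ : List V), w₁.length = g₁.length →
      walkSign (g₁ ++ g₂) v (w₁ ++ w₂) = walkSign g₁ v w₁ * walkSign g₂ (walkLast v w₁) w₂
  | [], g₂, v, [], w₂, _ => by simp
  | [], _, _, _ :: _, _, h => by simp at h
  | _ :: _, _, _, [], _, h => by simp at h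
  | l :: g₁, g₂, v, v' :: w₁, w₂, h => by
      simp only [List.cons_append, walkSign_cons_cons, walkLast_cons]
      rw [walkSign_append g₁ g₂ v' w₁ w₂ (by simpa using h), mul_assoc]

/-- Value of a walk through a concatenated graph (first part of matching length). [folklore] -/
theorem walkVal_append (η t : ℝ) :
    ∀ (g₁ g₂ : List (WLayer V K)) (v : V) (w₁ w₂ : List V), w₁.length = g₁.length →
      walkVal d η t (g₁ ++ g₂) v (w₁ ++ w₂)
        = walkVal d η t g₁ v w₁ * walkVal d η t g₂ (walkLast v w₁) w₂
  | [], g₂, v, [], w₂, _ => by simp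
  | [], _, _, _ :: _, _, h => by simp at h
  | _ :: _, _, _, [], _, h => by simp at h
  | l :: g₁, g₂, v, v' :: w₁, w₂, h => by
      simp only [List.cons_append, walkVal_cons_cons, walkLast_cons]
      rw [walkVal_append η t g₁ g₂ v' w₁ w₂ (by simpa using h), mul_assoc]

/-- Splitting a walk of finite cost through a concatenated graph at the seam. [folklore] -/
theorem walkCost_append_split (lam : ℤ) (g₁ g₂ : List (WLayer V K)) (v : V) (w : List V)
    (h : walkCost d lam (g₁ ++ g₂) v w ≠ ⊤) :
    (w.take g₁.length).length = g₁.length ∧ w = w.take g₁.length ++ w.drop g₁.length ∧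
      walkCost d lam (g₁ ++ g₂) v w
        = walkCost d lam g₁ v (w.take g₁.length)
          + walkCost d lam g₂ (walkLast v (w.take g₁.length)) (w.drop g₁.length) := by
  have hlen := length_eq_of_walkCost_ne_top d lam _ v w h
  have h1 : (w.take g₁.length).length = g₁.length := by
    rw [List.length_take, hlen, List.length_append]
    exact min_eq_left (Nat.le_add_right _ _)
  refine ⟨h1, (List.take_append_drop _ _).symm, ?_⟩
  conv_lhs => rw [← List.take_append_drop g₁.length w]
  exact walkCost_append d lam g₁ g₂ v _ _ h1

end append


/-! ### The arithmetic stub -/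

/-- Size bookkeeping for the staircase family: `((E-1)(n+1)+1)·(E·n·2) ≤ 4·E²·n²` for `n ≥ 1`
(`E = 2^L`: the number of columns times the number of vertices per column). [folklore] -/
theorem size_le (E n : ℕ) (hn : 1 ≤ n) :
    ((E - 1) * (n + 1) + 1) * (E * n * 2) ≤ 4 * E ^ 2 * n ^ 2 := by
  rcases Nat.eq_zero_or_pos E with hE | hE
  · subst hE; simp
  have h1 : (E - 1) * (n + 1) + 1 ≤ E * (2 * n) := by
    have : (E - 1) * (n + 1) + 1 ≤ (E - 1) * (2 * n) + 2 * n := by nlinarith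
    calc (E - 1) * (n + 1) + 1 ≤ (E - 1) * (2 * n) + 1 * (2 * n) := by nlinarith
      _ = (E - 1 + 1) * (2 * n) := by ring
      _ = E * (2 * n) := by rw [Nat.sub_add_cancel hE]
  calc ((E - 1) * (n + 1) + 1) * (E * n * 2) ≤ (E * (2 * n)) * (E * n * 2) :=
        Nat.mul_le_mul_right _ h1
    _ = 4 * E ^ 2 * n ^ 2 := by ring

/-- The arithmetic stub `stub_arith` of the refutation skeleton (line `staircase-refutation` of crux
stmt-ValiantsHypothesis-18500): with `L = 6a + 1` levels there is an even `n ≥ 2` such that `n^L − 1`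
alternations beat the iterated-Rolle bound `K · C^K · (m + K)^a` for `K = 6a + 3` classes and the
symmetrised size `m = 4·m₀³ + 7`, `m₀ = ((2^L − 1)(n+1) + 1) · (2^L · n · 2)`.  Proof: with `L = 6a+1`, `F = 256·4^{3L}… = 256·E^6 + L + 9` and
`D = (L+2)·C^{L+2}·F^a`, the even number `n = 2(D+1)` gives `n^L = n^{6a}·n ≥ D·n^{6a} + 2` while the
Rolle bound is at most `D·n^{6a}`. [folklore] -/
theorem stub_arith : ∀ C a : ℕ, ∃ n : ℕ, 2 ≤ n ∧ Even n ∧ (6 * a + 3) * C ^ (6 * a + 3) * (4 * (((2 ^ (6 * a + 1) - 1) * (n + 1) + 1) * (2 ^ (6 * a + 1) * n * 2)) ^ 3 + 7 + (6 * a + 3)) ^ a < n ^ (6 * a + 1) - 1 := by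
  intro C a
  set L := 6 * a + 1 with hL
  set E := 2 ^ L with hE
  set F := 256 * E ^ 6 + L + 9 with hF
  set D := (L + 2) * C ^ (L + 2) * F ^ a with hD
  refine ⟨2 * (D + 1), by omega, even_two_mul _, ?_⟩
  set n := 2 * (D + 1) with hn
  have hn1 : 1 ≤ n := by omega
  -- the symmetrised size is at most `F · n^6`
  have hsize : 4 * (((E - 1) * (n + 1) + 1) * (E * n * 2)) ^ 3 + 7 + (L + 2) ≤ F * n ^ 6 := by
    have h1 := size_le E n hn1
    have h2 : (((E - 1) * (n + 1) + 1) * (E * n * 2)) ^ 3 ≤ (4 * E ^ 2 * n ^ 2) ^ 3 :=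
      Nat.pow_le_pow_left h1 3
    have h3 : 1 ≤ n ^ 6 := Nat.one_le_pow _ _ hn1
    calc 4 * (((E - 1) * (n + 1) + 1) * (E * n * 2)) ^ 3 + 7 + (L + 2)
        ≤ 4 * (4 * E ^ 2 * n ^ 2) ^ 3 + (7 + (L + 2)) * n ^ 6 := by nlinarith
      _ = F * n ^ 6 := by rw [hF]; ring
  have hK : 6 * a + 3 = L + 2 := by omega
  rw [hK]
  have hbound : (L + 2) * C ^ (L + 2) *
      (4 * (((E - 1) * (n + 1) + 1) * (E * n * 2)) ^ 3 + 7 + (L + 2)) ^ a ≤ D * n ^ (6 * a) := by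
    calc (L + 2) * C ^ (L + 2) * (4 * (((E - 1) * (n + 1) + 1) * (E * n * 2)) ^ 3 + 7 + (L + 2)) ^ a
        ≤ (L + 2) * C ^ (L + 2) * (F * n ^ 6) ^ a :=
          Nat.mul_le_mul_left _ (Nat.pow_le_pow_left hsize a)
      _ = D * n ^ (6 * a) := by rw [hD, mul_pow, ← pow_mul]; ring
  have hpow : 1 ≤ n ^ (6 * a) := Nat.one_le_pow _ _ hn1
  have hmain : D * n ^ (6 * a) + 2 ≤ n ^ L := by
    have h1 : n ^ L = n ^ (6 * a) * n := by rw [hL, pow_succ]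
    have h2 : n ^ (6 * a) * n = 2 * (D * n ^ (6 * a)) + 2 * n ^ (6 * a) := by
      rw [hn]; ring
    rw [h1, h2]
    omega
  omega


end Summit.ValiantsHypothesis.ValiantsHypothesis.Theorems.SymmetroidDescartes.DPR
-- ===== END inline copy =====

namespace Summit.ValiantsHypothesis.ValiantsHypothesis.Theorems.SymmetroidDescartes.DPR

open scoped BigOperators
open Summit.ValiantsHypothesis.ValiantsHypothesis.Theses.SymmetroidDescartes

/-! ### Stubs (registered on the item with exactly these one-line signatures) -/

/-- STUB (dominance).  Unique min-cost walk with integer gap ⇒ the path sum at `t = η^(-lam)` is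
`walkSign(wstar)·η^c` up to `η^c/2`. [folklore] -/
theorem stub_walkSign : ∀ (V : Type) [Fintype V] [DecidableEq V] (K : ℕ) (d : Fin K → ℕ) (g : List (WLayer V K)) (v₀ : V) (lam : ℤ) (wstar : List V) (c : ℤ), walkCost d lam g v₀ wstar = (c : WithTop ℤ) → (∀ w : List V, w ≠ wstar → ((c + 1 : ℤ) : WithTop ℤ) ≤ walkCost d lam g v₀ w) → ∀ η : ℝ, 0 < η → η * (2 * (Fintype.card V : ℝ) ^ g.length) ≤ 1 → |pathSum d η (η ^ (-lam)) g v₀ - (walkSign g v₀ wstar : ℝ) * η ^ c| ≤ η ^ c / 2 := by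
  sorry

/-- STUB (path determinant).  An affine matrix (`I − Z₀ − W·u vᵀ`) whose determinant on the monomial
curve is `1 − W · pathSum`. [folklore] -/
theorem stub_walkDet : ∀ (V : Type) [Fintype V] [DecidableEq V] (K : ℕ) (d : Fin K → ℕ) (g : List (WLayer V K)) (v₀ : V) (η W : ℝ), ∃ A : Matrix (Fin ((g.length + 1) * Fintype.card V)) (Fin ((g.length + 1) * Fintype.card V)) (MvPolynomial (Fin K) ℝ), (∀ i j, (A i j).totalDegree ≤ 1) ∧ ∀ t : ℝ, (A.map (MvPolynomial.eval fun l => t ^ d l)).det = 1 - W * pathSum d η t g v₀ := by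
  sorry

/-- STUB (the staircase family).  Unique minimal walks with gap `≥ 1` and alternating signs at `n^L`
strictly increasing integer parameters. [folklore] -/
theorem stub_stair : ∀ (n L N : ℕ), 2 ≤ n → Even n → 1 ≤ L → N + 1 = n ^ L → ∃ (g : List (WLayer (Fin (2 ^ L * n) × Bool) (L + 1))) (d : Fin (L + 1) → ℕ) (v₀ : Fin (2 ^ L * n) × Bool) (lam : Fin (N + 1) → ℤ) (wstar : Fin (N + 1) → List (Fin (2 ^ L * n) × Bool)) (c : Fin (N + 1) → ℤ), g.length = (2 ^ L - 1) * (n + 1) ∧ StrictMono lam ∧ (∀ j, walkCost d (lam j) g v₀ (wstar j) = (c j : WithTop ℤ)) ∧ (∀ j (w : List (Fin (2 ^ L * n) × Bool)), w ≠ wstar j → ((c j + 1 : ℤ) : WithTop ℤ) ≤ walkCost d (lam j) g v₀ w) ∧ (∀ j, walkSign g v₀ (wstar j) = (-1) ^ (j : ℕ)) := by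
  sorry

/-! ### Composition -/

/-- From a unique-minimal-walk family to a SYMMETRIC lacunary pencil whose determinant alternates in
sign along a strictly increasing sequence of positive test points (dominance + path determinant +
GKKP symmetrisation from the tree). [folklore] -/
theorem exists_symm_pencil_alternating {V : Type} [Fintype V] [DecidableEq V] {K N : ℕ}
    (d : Fin K → ℕ) (g : List (WLayer V K)) (v₀ : V) (lam : Fin (N + 1) → ℤ)
    (wstar : Fin (N + 1) → List V) (c : Fin (N + 1) → ℤ) (hlam : StrictMono lam)
    (hc : ∀ j, walkCost d (lam j) g v₀ (wstar j) = (c j : WithTop ℤ))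
    (hgap : ∀ j (w : List V), w ≠ wstar j → (((c j + 1 : ℤ)) : WithTop ℤ) ≤ walkCost d (lam j) g v₀ w)
    (hsign : ∀ j, walkSign g v₀ (wstar j) = (-1) ^ (j : ℕ)) :
    ∃ (S : Fin (K + 1) → Matrix (Fin (4 * ((g.length + 1) * Fintype.card V) ^ 3 + 7))
        (Fin (4 * ((g.length + 1) * Fintype.card V) ^ 3 + 7)) ℝ) (e : Fin (K + 1) → ℕ),
      (∀ l, (S l).IsSymm) ∧ ∃ τ : Fin (N + 1) → ℝ, StrictMono τ ∧ (∀ j, 0 < τ j) ∧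
        ∀ j : Fin N,
          ((∑ l, (Polynomial.X : Polynomial ℝ) ^ e l • (S l).map Polynomial.C).det).eval (τ j.castSucc) *
          ((∑ l, (Polynomial.X : Polynomial ℝ) ^ e l • (S l).map Polynomial.C).det).eval (τ j.succ) < 0 := by
  classical
  -- the vertex set is nonempty (it contains `v₀`), so `|V| ≥ 1`
  have hcard : (1 : ℝ) ≤ Fintype.card V := by
    exact_mod_cast Fintype.card_pos_iff.2 ⟨v₀⟩
  -- the small base
  set η : ℝ := 1 / (2 * (Fintype.card V : ℝ) ^ g.length) with hη
  have hden : 0 < 2 * (Fintype.card V : ℝ) ^ g.length := by positivity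
  have hη0 : 0 < η := by rw [hη]; positivity
  have hη1 : η < 1 := by
    rw [hη, div_lt_one hden]
    have : (1 : ℝ) ≤ (Fintype.card V : ℝ) ^ g.length := one_le_pow₀ hcard
    linarith
  have hηle : η * (2 * (Fintype.card V : ℝ) ^ g.length) ≤ 1 := by
    rw [hη, div_mul_cancel₀ _ hden.ne']
  -- path sums at the test points: sign `(-1)^j`, size at least `η^c/2`
  set P : Fin (N + 1) → ℝ := fun j => pathSum d η (η ^ (-lam j)) g v₀ with hP
  have hPest : ∀ j, |P j - ((-1 : ℝ) ^ (j : ℕ)) * η ^ c j| ≤ η ^ c j / 2 := by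
    intro j
    have h := stub_walkSign V K d g v₀ (lam j) (wstar j) (c j) (hc j) (hgap j) η hη0 hηle
    simpa [hP, hsign j] using h
  have hpow : ∀ j, 0 < η ^ c j := fun j => zpow_pos hη0 _
  -- `(-1)^j * P j ≥ η^c/2 > 0`
  have hPsgn : ∀ j, η ^ c j / 2 ≤ (-1 : ℝ) ^ (j : ℕ) * P j := by
    intro j
    have h := hPest j
    rw [abs_le] at h
    rcases neg_one_pow_eq_or ℝ (j : ℕ) with h1 | h1 <;> rw [h1] at h ⊢ <;>
      [linarith [h.1]; linarith [h.2]]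
  have hPne : ∀ j, P j ≠ 0 := by
    intro j h0
    have := hPsgn j
    rw [h0, mul_zero] at this
    linarith [hpow j]
  -- the closing weight
  set W : ℝ := ∑ j, 2 / |P j| with hW
  have hWj : ∀ j, 2 ≤ W * |P j| := by
    intro j
    have hj : 2 / |P j| ≤ W := by
      rw [hW]
      exact Finset.single_le_sum (f := fun j => 2 / |P j|) (fun i _ => by positivity)
        (Finset.mem_univ j)
    calc (2 : ℝ) = 2 / |P j| * |P j| := by field_simp [abs_ne_zero.2 (hPne j)]
      _ ≤ W * |P j| := by gcongr
  -- the affine matrix with determinant `1 - W · pathSum`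
  obtain ⟨A, hAdeg, hAdet⟩ := stub_walkDet V K d g v₀ η W
  -- symmetrise (GKKP, tree) and restrict to the monomial curve (tree)
  have hrepr : Literature.Computability.AlgebraicComplexity.HasDetRepr A.det
      ((g.length + 1) * Fintype.card V) := ⟨A, hAdeg, rfl⟩
  obtain ⟨B, hBsymm, hBdeg, hBdet⟩ :=
    hasSymmAffineDetRepr_of_hasDetRepr (k := ℝ) (by norm_num) hrepr
  obtain ⟨S, e, hSsymm, hSeval⟩ := exists_symm_pencil_eval B hBdeg hBsymm d
  refine ⟨S, e, hSsymm, fun j => η ^ (-lam j), ?_, fun j => zpow_pos hη0 _, fun j => ?_⟩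
  · exact fun i j hij => zpow_right_strictAnti₀ hη0 hη1 (neg_lt_neg (hlam hij))
  · -- `det = 1 - W · P` at both test points, with signs `-(-1)^j` and `(-1)^j`
    have hdet : ∀ i : Fin (N + 1),
        ((∑ l, (Polynomial.X : Polynomial ℝ) ^ e l • (S l).map Polynomial.C).det).eval (η ^ (-lam i))
          = 1 - W * P i := by
      intro i
      rw [hSeval, hBdet, RingHom.map_det, RingHom.mapMatrix_apply, hAdet]
    rw [hdet j.castSucc, hdet j.succ]
    have key : ∀ i : Fin (N + 1), (-1 : ℝ) ^ (i : ℕ) * (1 - W * P i) ≤ -1 := by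
      intro i
      have h1 := hPsgn i
      have h2 := hWj i
      have h3 := hpow i
      rcases neg_one_pow_eq_or ℝ (i : ℕ) with h | h <;> rw [h] at h1 ⊢
      · have hPpos : 0 < P i := by linarith
        rw [abs_of_pos hPpos] at h2
        linarith
      · have hPneg : P i < 0 := by linarith
        rw [abs_of_neg hPneg] at h2
        linarith
    have k1 := key j.castSucc
    have k2 := key j.succ
    simp only [Fin.val_castSucc, Fin.val_succ, pow_succ] at k1 k2
    rcases neg_one_pow_eq_or ℝ (j : ℕ) with h | h <;> rw [h] at k1 k2 <;> nlinarith

end Summit.ValiantsHypothesis.ValiantsHypothesis.Theorems.SymmetroidDescartes.DPR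

namespace Summit.ValiantsHypothesis.ValiantsHypothesis.Theorems.SymmetroidDescartes

open Summit.ValiantsHypothesis.ValiantsHypothesis.Theses.SymmetroidDescartes

/-- **The crux `DerivedPencilRolle` (stmt-ValiantsHypothesis-18500) is false.**  By the tree lemma
`alternations_le_of_derivedPencilRolle`, the inductive matrix-Rolle step would bound the number of sign
alternations of the determinant of EVERY symmetric `K`-term lacunary pencil of size `m` by
`K · C^K · (m+K)^a`; the staircase family (`DPR.stub_stair`), read through dominance, the path
determinant and GKKP symmetrisation (`DPR.exists_symm_pencil_alternating`), gives symmetric pencils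
with `K = L + 2` terms, size `4 m₀³ + 7` (`m₀` polynomial in `n`) and `n^L − 1` alternations, which for
`L = 6a + 1` and `n` large (`DPR.stub_arith`) exceeds that bound. [folklore] -/
theorem not_DerivedPencilRolle : ¬ DerivedPencilRolle := by
  intro h
  obtain ⟨C, a, _, hbound⟩ := alternations_le_of_derivedPencilRolle h
  obtain ⟨n, hn, he, harith⟩ := DPR.stub_arith C a
  have hL1 : 1 ≤ 6 * a + 1 := by omega
  have hnL : 1 ≤ n ^ (6 * a + 1) := Nat.one_le_pow _ _ (by omega)
  obtain ⟨g, d, v₀, lam, wstar, c, hlen, hlam, hc, hgap, hsign⟩ :=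
    DPR.stub_stair n (6 * a + 1) (n ^ (6 * a + 1) - 1) hn he hL1 (Nat.sub_add_cancel hnL)
  obtain ⟨S, e, hS, τ, hτ, hpos, halt⟩ :=
    DPR.exists_symm_pencil_alternating d g v₀ lam wstar c hlam hc hgap hsign
  have hN := hbound (6 * a + 1 + 1 + 1) _ S e hS (n ^ (6 * a + 1) - 1) τ hτ hpos halt
  rw [hlen, Fintype.card_prod, Fintype.card_fin, Fintype.card_bool] at hN
  have hK : 6 * a + 1 + 1 + 1 = 6 * a + 3 := by ring
  rw [hK] at hN
  exact absurd harith (not_lt.2 hN)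

end Summit.ValiantsHypothesis.ValiantsHypothesis.Theorems.SymmetroidDescartes
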